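import Mathlib
import Summits.Ventures.Crystal3D.Theses.StickyWulffConstant
import Summits.Ventures.Crystal3D.Theorems.StickyWulffConstantTextureLiminfTexShadowDefs
import Summits.Ventures.Crystal3D.LocalLP.ContactBridge
import Summits.Ventures.Crystal3D.StickySpheres.FinsetBridge
import Literature.Analysis.Convexity.AnisotropicPerimeterTransform
import Literature.Analysis.Convexity.FinitePerimeterTransform
import Summits.Ventures.Crystal3D.Theorems.StickyWulffConstantTextureLiminfTexShadowVocabulary
import Summits.Ventures.Crystal3D.Theorems.StickyWulffConstantTextureLiminfUnsaturateSaturation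
import HarnessLib

/-!
# Line `TexShadow` (stmt-Ventures-19483, v6.2): the stub `stub_unsaturate` — the SATURATION WLOG — PROVED (part 2)

HONEST FRAMING. Part of the venture `Summits/Ventures/Crystal3D` (cell `crystal3d-full`), route
`route-Ventures-StickyWulffConstant`, crux `TextureLiminf` (stmt-Ventures-19483), `--supports` helper (file 2 of 2
of the literature seat's kernel-checked kit HOME/cf-lit/unsat/, lit gen 10; landed by the prover seat eng gen 9).
Proves, with no `sorry` and standard axioms, the registered stub `stub_unsaturate : ShadowTheoremSat → ShadowTheorem`
of the planner's skeleton `HOME/cf-p1/route/lines/tex/TexShadow.lean` v6.2 (cf-p1 ROUTE.md §73.1 / §73.13), BY NAME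
(`stub_unsaturate`, a one-line alias of `shadowTheorem_of_shadowTheoremSat`), against the vocabulary file
`…TexShadowVocabulary.lean`; part 1 (`…UnsaturateSaturation.lean`) is the saturation lemma `exists_saturated`.

* §4 dilation of textures: `per_smul` (`per K (r • S) = r² · per K S`), `iface_smul`, `energy_smul` (`= r²·energy`),
  `vol_smul` (`= r³·vol`), `isTexture_smul` (Literature: `anisotropicPerimeter_smul`, `HasFinitePerimeter.smul`,
  `Measure.addHaar_smul`);
* §5 `shadowTheorem_of_shadowTheoremSat`: saturate; apply the saturated theorem at `(2K₊, δ/2, θ/2)`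
  (`K₊ = max K 0`; for `N ≥ (2K₊)³, (2K₊/δ)³, 2N₀'+1`: `N/2 ≤ N' ≤ 3N/2`, `N' ≥ (1 − δ/2)N`, `D' ≤ 2K₊ N'^{2/3}`);
  dilate the texture by `λ = (N'/N)^{1/3}` (`vol ↦ (N'/N)·vol`, `energy ↦ (N'/N)^{2/3}·energy ≤ D'/N^{2/3} + 3θ/4`).
  (`div_rpow_le_of_drop` of the planner's sketch is not needed.)  `stub_unsaturate` = the registered name.
WHAT THIS IS NOT: any progress on `stub_textureBuild`, `stub_bilayerWall`, `stub_barlowAdhesionR`,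
`stub_resolution`, `stub_barlowFreeCertificate`; rung F-C1 not moved.
-/

open scoped BigOperators InnerProductSpace ENNReal Pointwise
open MeasureTheory Filter Finset

namespace Summit.Ventures.Crystal3D.Cruxes.TextureLiminf.TexShadow

open Summit.Ventures.Crystal3D
open Literature.MathematicalPhysics.StatisticalMechanics (fccStacking barlowStacking IsHaggSeq
  fieldDivergence HasFinitePerimeter perimeter contactDeficiency orderedContacts)
open Literature.Analysis.Convexity (anisotropicPerimeter anisotropicPerimeter_smul perimeter_smul
  perimeter_eq_anisotropicPerimeter_closedBall)

/-! ## §4 Dilation of textures -/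

section Dilation

/-- `dim ℝ³ = 3`. -/
private theorem finrank_E3 : Module.finrank ℝ E3 = 3 := by
  rw [finrank_euclideanSpace, Fintype.card_fin]

/-- `per K (r • S) = r² · per K S` (`r > 0`). -/
theorem per_smul (K S : Set E3) {r : ℝ} (hr : 0 < r) : per K (r • S) = r ^ 2 * per K S := by
  rw [per, per, perK_eq_anisotropicPerimeter, perK_eq_anisotropicPerimeter, anisotropicPerimeter_smul _ _ hr,
    finrank_E3, ENNReal.toReal_mul, ENNReal.toReal_ofReal (pow_nonneg hr.le _)]

/-- `iface K (r • A) (r • B) = r² · iface K A B` (`r > 0`). -/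
theorem iface_smul (K A B : Set E3) {r : ℝ} (hr : 0 < r) :
    iface K (r • A) (r • B) = r ^ 2 * iface K A B := by
  rw [iface, iface, ← Set.smul_set_union, per_smul _ _ hr, per_smul _ _ hr, per_smul _ _ hr]
  ring

/-- `energy` of the dilated texture `= r² · energy` (`r > 0`). -/
theorem energy_smul (n : ℕ) (G : Fin n → Set E3) (A : Fin n → (E3 ≃ₗᵢ[ℝ] E3))
    (c : Fin n → Fin n → ℝ) (m : Fin n → Fin n → E3) {r : ℝ} (hr : 0 < r) :
    energy n (fun f => r • G f) A c m = r ^ 2 * energy n G A c m := by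
  simp only [energy, per_smul _ _ hr, iface_smul _ _ _ hr]
  have h1 : ∀ f g : Fin n, (if f = g then (0 : ℝ) else r ^ 2 * iface (wulffOf (A f)) (G f) (G g)) =
      r ^ 2 * (if f = g then (0 : ℝ) else iface (wulffOf (A f)) (G f) (G g)) := by
    intro f g; split_ifs <;> simp
  have h2 : ∀ f g : Fin n,
      (if f = g then (0 : ℝ) else c f g / 2 * (r ^ 2 * iface (wallBody (m f g)) (G f) (G g))) =
      r ^ 2 * (if f = g then (0 : ℝ) else c f g / 2 * iface (wallBody (m f g)) (G f) (G g)) := by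
    intro f g; split_ifs <;> ring
  simp only [h1, h2, ← Finset.mul_sum]
  ring

/-- `vol` of the dilated texture `= r³ · vol` (`r ≥ 0`). -/
theorem vol_smul (n : ℕ) (G : Fin n → Set E3) {r : ℝ} (hr : 0 ≤ r) :
    vol n (fun f => r • G f) = r ^ 3 * vol n G := by
  rw [vol, vol, ← Set.smul_set_iUnion, Measure.addHaar_smul, finrank_E3, ENNReal.toReal_mul,
    ENNReal.toReal_ofReal (by positivity), abs_of_nonneg (pow_nonneg hr 3)]

/-- `IsTexture` is invariant under positive dilation of all grains. -/
theorem isTexture_smul {c₀ c₁ : ℝ} {n : ℕ} {G : Fin n → Set E3} {A : Fin n → (E3 ≃ₗᵢ[ℝ] E3)}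
    {c : Fin n → Fin n → ℝ} {m : Fin n → Fin n → E3} (h : IsTexture c₀ c₁ n G A c m) {r : ℝ} (hr : 0 < r) :
    IsTexture c₀ c₁ n (fun f => r • G f) A c m := by
  obtain ⟨hfin, hdisj, hc, hnc, hco⟩ := h
  refine ⟨fun f => ⟨(hfin f).1.smul hr, ?_⟩, fun f g hfg => ?_, hc, hnc, hco⟩
  · rw [Measure.addHaar_smul]
    exact ENNReal.mul_lt_top ENNReal.ofReal_lt_top (hfin f).2
  · show Disjoint (r • G f) (r • G g)
    rw [← Set.image_smul, ← Set.image_smul]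
    exact (Set.disjoint_image_iff (MulAction.injective₀ hr.ne')).2 (hdisj f g hfg)

end Dilation

/-! ## §5 `stub_unsaturate`: the saturated shadow theorem implies the shadow theorem -/

section Assembly

/-- cube-root bookkeeping: `0 ≤ a`, `a³ ≤ N` ⇒ `a · N^{2/3} ≤ N`. -/
private theorem mul_rpow_two_thirds_le {a N : ℝ} (ha : 0 ≤ a) (hN : 0 ≤ N) (h : a ^ 3 ≤ N) :
    a * N ^ ((2 : ℝ) / 3) ≤ N := by
  have h13 : a ≤ N ^ ((1 : ℝ) / 3) := by
    calc a = (a ^ 3) ^ ((1 : ℝ) / 3) := by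
          rw [← Real.rpow_natCast, ← Real.rpow_mul ha]; norm_num
      _ ≤ N ^ ((1 : ℝ) / 3) := Real.rpow_le_rpow (pow_nonneg ha 3) h (by norm_num)
  calc a * N ^ ((2 : ℝ) / 3) ≤ N ^ ((1 : ℝ) / 3) * N ^ ((2 : ℝ) / 3) :=
        mul_le_mul_of_nonneg_right h13 (Real.rpow_nonneg hN _)
    _ = N ^ ((1 : ℝ) / 3 + (2 : ℝ) / 3) := (Real.rpow_add' hN (by norm_num)).symm
    _ = N := by norm_num

/-- **`stub_unsaturate`** (TexShadow v6.2, ROUTE.md §73.1): the shadow theorem for 6|6-saturated clusters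
implies the shadow theorem.  Saturate (`exists_saturated`: `s` steps, `D' + s ≤ D`, `|N' − N| ≤ s`), apply the
saturated theorem with `(2Kp, δ/2, θ/2)` (`Kp = max K 0`; for `N ≥ (2Kp)³`, `(2Kp/δ)³`, `2N₀' + 1` one has
`N/2 ≤ N' ≤ 3N/2`, `N' ≥ (1 − δ/2)N`, `D' ≤ 2Kp N'^{2/3}`), and DILATE the texture by `λ = (N'/N)^{1/3}`:
`vol ↦ (N'/N)·vol`, `energy ↦ (N'/N)^{2/3}·energy ≤ D'/N^{2/3} + (3/2)·θ/2`. -/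
theorem shadowTheorem_of_shadowTheoremSat (hSat : ShadowTheoremSat) : ShadowTheorem := by
  intro hG hF hNRG hSL K δ θ hδ hθ
  -- nonnegative version of `K`
  set Kp : ℝ := max K 0 with hKp
  have hKp0 : 0 ≤ Kp := le_max_right _ _
  have hKK : K ≤ Kp := le_max_left _ _
  obtain ⟨N₀', hN₀'⟩ := hSat hG hF hNRG hSL (2 * Kp) (δ / 2) (θ / 2) (by positivity) (by positivity)
  obtain ⟨M, hM⟩ := exists_nat_ge (max ((2 * Kp) ^ 3) ((2 * Kp / δ) ^ 3))
  refine ⟨M + 2 * N₀' + 1, fun N hN x hx hD => ?_⟩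
  have hN1 : (1 : ℝ) ≤ N := by exact_mod_cast (show 1 ≤ N by omega)
  have hNpos : (0 : ℝ) < N := by linarith
  have hNM : (M : ℝ) ≤ N := by exact_mod_cast (show M ≤ N by omega)
  have hN₀'N : 2 * (N₀' : ℝ) + 1 ≤ N := by exact_mod_cast (show 2 * N₀' + 1 ≤ N by omega)
  have hNr0 : (0 : ℝ) ≤ (N : ℝ) ^ ((2 : ℝ) / 3) := Real.rpow_nonneg hNpos.le _
  -- the two cube-root bounds on `B = Kp N^{2/3}`
  have hB1 : Kp * (N : ℝ) ^ ((2 : ℝ) / 3) ≤ N / 2 := by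
    have h : (2 * Kp) ^ 3 ≤ (N : ℝ) := (le_max_left _ _).trans (hM.trans hNM)
    have := mul_rpow_two_thirds_le (by positivity) hNpos.le h
    linarith
  have hB2 : Kp * (N : ℝ) ^ ((2 : ℝ) / 3) ≤ δ / 2 * N := by
    have h : (2 * Kp / δ) ^ 3 ≤ (N : ℝ) := (le_max_right _ _).trans (hM.trans hNM)
    have h' := mul_rpow_two_thirds_le (by positivity) hNpos.le h
    have heq : Kp * (N : ℝ) ^ ((2 : ℝ) / 3) = δ / 2 * (2 * Kp / δ * (N : ℝ) ^ ((2 : ℝ) / 3)) := by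
      field_simp
    rw [heq]
    exact mul_le_mul_of_nonneg_left h' (by positivity)
  have hDK : 6 * (N : ℝ) - (numContacts x : ℝ) ≤ Kp * (N : ℝ) ^ ((2 : ℝ) / 3) :=
    hD.trans (mul_le_mul_of_nonneg_right hKK hNr0)
  -- saturate
  obtain ⟨N', x', s, hx', hsat', hNle, hN'le, hD's, -⟩ := exists_saturated x hx
  have hs0 : (0 : ℝ) ≤ s := Nat.cast_nonneg _
  have hC' : (numContacts x' : ℝ) ≤ 6 * N' := by exact_mod_cast numContacts_le_six_mul hx'
  have hD'0 : (0 : ℝ) ≤ 6 * (N' : ℝ) - (numContacts x' : ℝ) := by linarith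
  have hsB : (s : ℝ) ≤ Kp * (N : ℝ) ^ ((2 : ℝ) / 3) := by linarith
  -- size of `N'`
  have hN'lo : (N : ℝ) / 2 ≤ N' := by linarith
  have hN'lo' : (1 - δ / 2) * N ≤ N' := by linarith
  have hN'hi : (N' : ℝ) ≤ 3 / 2 * N := by linarith
  have hN'pos : (0 : ℝ) < N' := by linarith
  have hN'ge : N₀' ≤ N' := by exact_mod_cast (show (N₀' : ℝ) ≤ N' by linarith)
  have hN'r0 : (0 : ℝ) ≤ (N' : ℝ) ^ ((2 : ℝ) / 3) := Real.rpow_nonneg hN'pos.le _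
  -- deficiency bound for the saturated cluster
  have hD'K : 6 * (N' : ℝ) - (numContacts x' : ℝ) ≤ 2 * Kp * (N' : ℝ) ^ ((2 : ℝ) / 3) := by
    have h1 : 6 * (N' : ℝ) - (numContacts x' : ℝ) ≤ Kp * (N : ℝ) ^ ((2 : ℝ) / 3) := by linarith
    have h2 : (N : ℝ) ^ ((2 : ℝ) / 3) ≤ (2 * (N' : ℝ)) ^ ((2 : ℝ) / 3) :=
      Real.rpow_le_rpow hNpos.le (by linarith) (by norm_num)
    have h3 : (2 * (N' : ℝ)) ^ ((2 : ℝ) / 3) = (2 : ℝ) ^ ((2 : ℝ) / 3) * (N' : ℝ) ^ ((2 : ℝ) / 3) :=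
      Real.mul_rpow (by norm_num) hN'pos.le
    have h4 : (2 : ℝ) ^ ((2 : ℝ) / 3) ≤ 2 := by
      conv_rhs => rw [← Real.rpow_one 2]
      exact Real.rpow_le_rpow_of_exponent_le (by norm_num) (by norm_num)
    calc 6 * (N' : ℝ) - (numContacts x' : ℝ) ≤ Kp * (N : ℝ) ^ ((2 : ℝ) / 3) := h1
      _ ≤ Kp * ((2 : ℝ) ^ ((2 : ℝ) / 3) * (N' : ℝ) ^ ((2 : ℝ) / 3)) := by
          rw [← h3]; exact mul_le_mul_of_nonneg_left h2 hKp0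
      _ ≤ Kp * (2 * (N' : ℝ) ^ ((2 : ℝ) / 3)) :=
          mul_le_mul_of_nonneg_left (mul_le_mul_of_nonneg_right h4 hN'r0) hKp0
      _ = 2 * Kp * (N' : ℝ) ^ ((2 : ℝ) / 3) := by ring
  -- the saturated theorem gives a texture for `x'`
  obtain ⟨n, G, A, c, m, hT, hvol, hEn⟩ := hN₀' N' hN'ge x' hx' hsat' hD'K
  -- dilation factor `λ = (N'/N)^{1/3}`
  set t : ℝ := (N' : ℝ) / N with ht
  have ht0 : 0 < t := by positivity
  set lam : ℝ := t ^ ((1 : ℝ) / 3) with hlam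
  have hlam0 : 0 < lam := Real.rpow_pos_of_pos ht0 _
  have hlam3 : lam ^ 3 = t := by
    rw [hlam, ← Real.rpow_natCast, ← Real.rpow_mul ht0.le]; norm_num
  have hlam2 : lam ^ 2 = t ^ ((2 : ℝ) / 3) := by
    rw [hlam, ← Real.rpow_natCast, ← Real.rpow_mul ht0.le]; norm_num
  refine ⟨n, fun f => lam • G f, A, c, m, isTexture_smul hT hlam0, ?_, ?_⟩
  · -- mass: `√2 · t · vol ≥ (1 − δ/2)² ≥ 1 − δ`
    rw [vol_smul n G hlam0.le, hlam3]
    have hvol0 : 0 ≤ vol n G := ENNReal.toReal_nonneg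
    have ht1 : 1 - δ / 2 ≤ t := by
      rw [ht, le_div_iff₀ hNpos]; linarith
    by_cases hδ1 : δ / 2 ≤ 1
    · have h0 : 0 ≤ 1 - δ / 2 := by linarith
      calc 1 - δ ≤ (1 - δ / 2) * (1 - δ / 2) := by nlinarith
        _ ≤ t * (Real.sqrt 2 * vol n G) := mul_le_mul ht1 hvol h0 ht0.le
        _ = Real.sqrt 2 * (t * vol n G) := by ring
    · have : 0 ≤ Real.sqrt 2 * (t * vol n G) := by positivity
      linarith
  · -- energy: `t^{2/3} · (D'/N'^{2/3} + θ/2) = D'/N^{2/3} + t^{2/3} θ/2 ≤ D/N^{2/3} + θ`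
    rw [energy_smul n G A c m hlam0, hlam2]
    have hNr : (0 : ℝ) < (N : ℝ) ^ ((2 : ℝ) / 3) := Real.rpow_pos_of_pos hNpos _
    have hN'r : (0 : ℝ) < (N' : ℝ) ^ ((2 : ℝ) / 3) := Real.rpow_pos_of_pos hN'pos _
    have htr : t ^ ((2 : ℝ) / 3) = (N' : ℝ) ^ ((2 : ℝ) / 3) / (N : ℝ) ^ ((2 : ℝ) / 3) := by
      rw [ht, Real.div_rpow hN'pos.le hNpos.le]
    have ht32 : t ^ ((2 : ℝ) / 3) ≤ 3 / 2 := by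
      have ht' : t ≤ 3 / 2 := by rw [ht, div_le_iff₀ hNpos]; linarith
      calc t ^ ((2 : ℝ) / 3) ≤ (3 / 2 : ℝ) ^ ((2 : ℝ) / 3) := Real.rpow_le_rpow ht0.le ht' (by norm_num)
        _ ≤ (3 / 2 : ℝ) ^ (1 : ℝ) := Real.rpow_le_rpow_of_exponent_le (by norm_num) (by norm_num)
        _ = 3 / 2 := Real.rpow_one _
    have ht23_0 : 0 ≤ t ^ ((2 : ℝ) / 3) := Real.rpow_nonneg ht0.le _
    have h1 : t ^ ((2 : ℝ) / 3) * energy n G A c m ≤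
        t ^ ((2 : ℝ) / 3) * ((6 * (N' : ℝ) - (numContacts x' : ℝ)) / (N' : ℝ) ^ ((2 : ℝ) / 3) + θ / 2) :=
      mul_le_mul_of_nonneg_left hEn ht23_0
    have h2 : t ^ ((2 : ℝ) / 3) * ((6 * (N' : ℝ) - (numContacts x' : ℝ)) / (N' : ℝ) ^ ((2 : ℝ) / 3)) =
        (6 * (N' : ℝ) - (numContacts x' : ℝ)) / (N : ℝ) ^ ((2 : ℝ) / 3) := by
      rw [htr]; field_simp
    have h3 : (6 * (N' : ℝ) - (numContacts x' : ℝ)) / (N : ℝ) ^ ((2 : ℝ) / 3) ≤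
        (6 * (N : ℝ) - (numContacts x : ℝ)) / (N : ℝ) ^ ((2 : ℝ) / 3) :=
      div_le_div_of_nonneg_right (by linarith) hNr.le
    have h4 : t ^ ((2 : ℝ) / 3) * (θ / 2) ≤ 3 / 2 * (θ / 2) :=
      mul_le_mul_of_nonneg_right ht32 (by positivity)
    calc t ^ ((2 : ℝ) / 3) * energy n G A c m
        ≤ t ^ ((2 : ℝ) / 3) * ((6 * (N' : ℝ) - (numContacts x' : ℝ)) / (N' : ℝ) ^ ((2 : ℝ) / 3) + θ / 2) := h1
      _ = (6 * (N' : ℝ) - (numContacts x' : ℝ)) / (N : ℝ) ^ ((2 : ℝ) / 3) + t ^ ((2 : ℝ) / 3) * (θ / 2) := by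
          rw [mul_add, h2]
      _ ≤ (6 * (N : ℝ) - (numContacts x : ℝ)) / (N : ℝ) ^ ((2 : ℝ) / 3) + θ := by linarith

end Assembly

/-- **The registered stub `stub_unsaturate` of TexShadow v6.2** (the saturation WLOG, ROUTE.md §73.1): the shadow
theorem for 6|6-saturated clusters implies it for all clusters. -/
theorem stub_unsaturate : ShadowTheoremSat → ShadowTheorem := shadowTheorem_of_shadowTheoremSat

end Summit.Ventures.Crystal3D.Cruxes.TextureLiminf.TexShadow
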